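import Mathlib
import Summits.QuantumAdvantage.QuantumAdvantage.Theorems.ArithStatLadderIqThreeNotPPolyStubFundDensityAP

/-!
# Stub `stub_densityNagell` of line `Sketch` (v4) for the crux `ArithStatLadder.IqThreeNotPPoly`

YES-density of the planted Nagell family. For the `6`-free core `G` (squarefree, odd, prime to `3`,
`0 < G < 2^n`) of a squarefree modulus and a seed `j < K := 2^(4n+8)` the sampler outputs
`d_j = G t (G t + 8) (4 G t + 27)` with `t = a₂ + 30 G j`, `a₂ := 1 + 11 G + 11 G²`. Granting
* the product lemma (first antecedent, = the neighbour stub `stub_sqfreeProductNagell`):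
  `t`, `G t + 8`, `4 G t + 27` squarefree ⇒ `d_j` squarefree, and
* the elementary squarefree sieve in an arithmetic progression (second antecedent, = the landed
  `stub_apSieve`): `(p₀ − 1) · #{k < K : a + q k not squarefree} ≤ K + (p₀ − 1) √(a + q K)` for
  coprime `(a, q)` when every prime not dividing `q` is `≥ p₀`,
at least one quarter of the seeds give a squarefree `d_j`, for every `n ≥ 3`.

Mathematics. The three moving factors are arithmetic progressions in `j`:
`t = a₂ + (30 G) j`, `G t + 8 = (G a₂ + 8) + (30 G²) j`, `4 G t + 27 = (4 G a₂ + 27) + (120 G²) j`.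
Their starts are coprime to the moduli: `a₂ ≡ 1 (mod G)`, `G a₂ + 8 ≡ 8 (mod G)` (`G` odd),
`4 G a₂ + 27 ≡ 27 (mod G)` (`3 ∤ G`), and none of them is divisible by `2`, `3` or `5` (a finite
residue computation in `ZMod p`, using `G` odd for the second start mod `2` and `3 ∤ G` for the
third start mod `3`). Since `30` divides each modulus, every prime not dividing it is `≥ 7`, so
the sieve gives `6 · badᵢ ≤ K + 6 √(aᵢ + qᵢ K)`; covering `K ≤ good + bad₂ + bad₃ + bad₄` and the
size bounds `√(aᵢ + qᵢ K) ≤ 8 · 2^(3n+4)` (`i = 2, 3`), `≤ 16 · 2^(3n+4)` (`i = 4`) with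
`128 · 2^(3n+4) ≤ K` (`n ≥ 3`) give `K ≤ 4 · good` by linear arithmetic.
-/

set_option linter.dupNamespace false -- D-0017: single-problem summit ⇒ QuantumAdvantage.QuantumAdvantage by design

namespace Summit.QuantumAdvantage.QuantumAdvantage.Theorems.IqThreeNotPPoly

open scoped Classical
open Finset

/-! ## Residues and coprimality of the three starts -/

/-- Coprimality to `120 = 2³ · 3 · 5` from non-divisibility by `2`, `3` and `5`. -/
theorem nagD_coprime_120 {a : ℕ} (h2 : ¬ 2 ∣ a) (h3 : ¬ 3 ∣ a) (h5 : ¬ 5 ∣ a) :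
    Nat.Coprime a 120 := by
  have c2 := ((Nat.Prime.coprime_iff_not_dvd Nat.prime_two).2 h2).symm
  have c3 := ((Nat.Prime.coprime_iff_not_dvd Nat.prime_three).2 h3).symm
  have c5 := ((Nat.Prime.coprime_iff_not_dvd Nat.prime_five).2 h5).symm
  have e : (120 : ℕ) = 2 ^ 3 * 3 * 5 := by norm_num
  rw [e]
  exact ((c2.pow_right 3).mul_right c3).mul_right c5

/-- Coprimality to `30` from non-divisibility by `2`, `3` and `5`. -/
theorem nagD_coprime_30 {a : ℕ} (h2 : ¬ 2 ∣ a) (h3 : ¬ 3 ∣ a) (h5 : ¬ 5 ∣ a) :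
    Nat.Coprime a 30 :=
  (nagD_coprime_120 h2 h3 h5).coprime_dvd_right (by norm_num)

/-- The first start `a₂ = 1 + 11 G + 11 G²` is divisible by none of `2`, `3`, `5` (for every `G`:
a residue computation in `ZMod p`). -/
theorem nagD_start₂_not_dvd (G : ℕ) :
    ¬ 2 ∣ 1 + 11 * G + 11 * G ^ 2 ∧ ¬ 3 ∣ 1 + 11 * G + 11 * G ^ 2 ∧
      ¬ 5 ∣ 1 + 11 * G + 11 * G ^ 2 := by
  refine ⟨?_, ?_, ?_⟩
  · rw [← ZMod.natCast_eq_zero_iff]; push_cast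
    generalize (G : ZMod 2) = x; revert x; decide
  · rw [← ZMod.natCast_eq_zero_iff]; push_cast
    generalize (G : ZMod 3) = x; revert x; decide
  · rw [← ZMod.natCast_eq_zero_iff]; push_cast
    generalize (G : ZMod 5) = x; revert x; decide

/-- The second start `G a₂ + 8` is divisible by none of `2`, `3`, `5` when `G` is odd. -/
theorem nagD_start₃_not_dvd {G : ℕ} (hG2 : ¬ 2 ∣ G) :
    ¬ 2 ∣ G * (1 + 11 * G + 11 * G ^ 2) + 8 ∧ ¬ 3 ∣ G * (1 + 11 * G + 11 * G ^ 2) + 8 ∧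
      ¬ 5 ∣ G * (1 + 11 * G + 11 * G ^ 2) + 8 := by
  refine ⟨?_, ?_, ?_⟩
  · have h : (G : ZMod 2) ≠ 0 := fun h => hG2 ((ZMod.natCast_eq_zero_iff G 2).1 h)
    rw [← ZMod.natCast_eq_zero_iff]; push_cast
    revert h; generalize (G : ZMod 2) = x; revert x; decide
  · rw [← ZMod.natCast_eq_zero_iff]; push_cast
    generalize (G : ZMod 3) = x; revert x; decide
  · rw [← ZMod.natCast_eq_zero_iff]; push_cast
    generalize (G : ZMod 5) = x; revert x; decide

/-- The third start `4 G a₂ + 27` is divisible by none of `2`, `3`, `5` when `3 ∤ G`. -/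
theorem nagD_start₄_not_dvd {G : ℕ} (hG3 : ¬ 3 ∣ G) :
    ¬ 2 ∣ 4 * G * (1 + 11 * G + 11 * G ^ 2) + 27 ∧ ¬ 3 ∣ 4 * G * (1 + 11 * G + 11 * G ^ 2) + 27 ∧
      ¬ 5 ∣ 4 * G * (1 + 11 * G + 11 * G ^ 2) + 27 := by
  refine ⟨?_, ?_, ?_⟩
  · rw [← ZMod.natCast_eq_zero_iff]; push_cast
    generalize (G : ZMod 2) = x; revert x; decide
  · have h : (G : ZMod 3) ≠ 0 := fun h => hG3 ((ZMod.natCast_eq_zero_iff G 3).1 h)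
    rw [← ZMod.natCast_eq_zero_iff]; push_cast
    revert h; generalize (G : ZMod 3) = x; revert x; decide
  · rw [← ZMod.natCast_eq_zero_iff]; push_cast
    generalize (G : ZMod 5) = x; revert x; decide

/-- `gcd(a₂, 30 G) = 1`: `a₂ = 1 + G (11 + 11 G) ≡ 1 (mod G)` and `a₂` is prime to `30`. -/
theorem nagD_coprime₂ (G : ℕ) : Nat.Coprime (1 + 11 * G + 11 * G ^ 2) (30 * G) := by
  obtain ⟨h2, h3, h5⟩ := nagD_start₂_not_dvd G
  refine (nagD_coprime_30 h2 h3 h5).mul_right ?_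
  have e : 1 + 11 * G + 11 * G ^ 2 = 1 + G * (11 + 11 * G) := by ring
  rw [e]
  exact (Nat.coprime_add_mul_left_left 1 G (11 + 11 * G)).2 (Nat.coprime_one_left G)

/-- `gcd(G a₂ + 8, 30 G²) = 1` for odd `G`: `≡ 8 (mod G)` with `gcd(8, G) = 1`, and prime to
`30`. -/
theorem nagD_coprime₃ {G : ℕ} (hG2 : ¬ 2 ∣ G) :
    Nat.Coprime (G * (1 + 11 * G + 11 * G ^ 2) + 8) (30 * G ^ 2) := by
  obtain ⟨h2, h3, h5⟩ := nagD_start₃_not_dvd hG2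
  refine (nagD_coprime_30 h2 h3 h5).mul_right (Nat.Coprime.pow_right 2 ?_)
  have h8 : Nat.Coprime 8 G := by
    simpa using ((Nat.Prime.coprime_iff_not_dvd Nat.prime_two).2 hG2).pow_left 3
  exact (Nat.coprime_mul_left_add_left 8 G (1 + 11 * G + 11 * G ^ 2)).2 h8

/-- `gcd(4 G a₂ + 27, 120 G²) = 1` when `3 ∤ G`: `≡ 27 (mod G)` with `gcd(27, G) = 1`, and prime
to `120`. -/
theorem nagD_coprime₄ {G : ℕ} (hG3 : ¬ 3 ∣ G) :
    Nat.Coprime (4 * G * (1 + 11 * G + 11 * G ^ 2) + 27) (120 * G ^ 2) := by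
  obtain ⟨h2, h3, h5⟩ := nagD_start₄_not_dvd hG3
  refine (nagD_coprime_120 h2 h3 h5).mul_right (Nat.Coprime.pow_right 2 ?_)
  have h27 : Nat.Coprime 27 G := by
    simpa using ((Nat.Prime.coprime_iff_not_dvd Nat.prime_three).2 hG3).pow_left 3
  have e : 4 * G * (1 + 11 * G + 11 * G ^ 2) + 27 = G * (4 * (1 + 11 * G + 11 * G ^ 2)) + 27 := by
    ring
  rw [e]
  exact (Nat.coprime_mul_left_add_left 27 G (4 * (1 + 11 * G + 11 * G ^ 2))).2 h27

/-- A prime not dividing a multiple of `30` is `≥ 7`. -/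
theorem nagD_seven_le {p q : ℕ} (hp : p.Prime) (h30 : 30 ∣ q) (hn : ¬ p ∣ q) : 7 ≤ p := by
  by_contra h
  have h2p := hp.two_le
  interval_cases p
  · exact hn ((by norm_num : (2 : ℕ) ∣ 30).trans h30)
  · exact hn ((by norm_num : (3 : ℕ) ∣ 30).trans h30)
  · exact absurd hp (by norm_num)
  · exact hn ((by norm_num : (5 : ℕ) ∣ 30).trans h30)
  · exact absurd hp (by norm_num)

/-! ## Counting -/

/-- Covering bound with three bad sets: if `A k ∧ B k ∧ C k → P k` then
`range K ⊆ {P} ∪ {¬A} ∪ {¬B} ∪ {¬C}`, so `K ≤ #{P} + #{¬A} + #{¬B} + #{¬C}`. -/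
theorem nagD_le_card_add₃ {K : ℕ} {P A B C : ℕ → Prop} [DecidablePred P] [DecidablePred A]
    [DecidablePred B] [DecidablePred C] (h : ∀ k, A k → B k → C k → P k) :
    K ≤ ((Finset.range K).filter P).card + ((Finset.range K).filter (fun k => ¬ A k)).card +
      ((Finset.range K).filter (fun k => ¬ B k)).card +
      ((Finset.range K).filter (fun k => ¬ C k)).card := by
  calc K = (Finset.range K).card := (Finset.card_range K).symm
    _ ≤ ((Finset.range K).filter P ∪ (Finset.range K).filter (fun k => ¬ A k) ∪
          (Finset.range K).filter (fun k => ¬ B k) ∪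
          (Finset.range K).filter (fun k => ¬ C k)).card := by
        apply Finset.card_le_card
        intro k hk
        simp only [Finset.mem_union, Finset.mem_filter]
        by_cases hA : A k
        · by_cases hB : B k
          · by_cases hC : C k
            · exact Or.inl (Or.inl (Or.inl ⟨hk, h k hA hB hC⟩))
            · exact Or.inr ⟨hk, hC⟩
          · exact Or.inl (Or.inr ⟨hk, hB⟩)
        · exact Or.inl (Or.inl (Or.inr ⟨hk, hA⟩))
    _ ≤ _ := (Finset.card_union_le _ _).trans (Nat.add_le_add_right
          ((Finset.card_union_le _ _).trans
            (Nat.add_le_add_right (Finset.card_union_le _ _) _)) _)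

/-- The density core: three instances of the AP sieve `hS` at `p₀ = 7`, a sufficient condition
`Squarefree (a₂ + q₂ k) ∧ Squarefree (a₃ + q₃ k) ∧ Squarefree (a₄ + q₄ k) → P k`, and the size
bounds `aᵢ + qᵢ K ≤ cᵢ² G² K` (`c = 8, 8, 16`) give `K ≤ 4 · #{k < K : P k}` for `K = 2^(4n+8)`,
`G < 2^n`, `n ≥ 3` (square roots bounded by `fundAP_sqrt_le` of the sibling stub
`stub_fundDensityAP`). -/
theorem nagD_density_core
    (hS : ∀ (a q K p₀ : ℕ), 0 < q → Nat.Coprime a q → 2 ≤ p₀ →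
      (∀ p : ℕ, p.Prime → ¬ p ∣ q → p₀ ≤ p) →
        (p₀ - 1) * ((Finset.range K).filter (fun k => ¬ Squarefree (a + q * k))).card ≤
          K + (p₀ - 1) * Nat.sqrt (a + q * K))
    {n G : ℕ} {P : ℕ → Prop} [DecidablePred P] {a₂ q₂ a₃ q₃ a₄ q₄ : ℕ}
    (hn : 3 ≤ n) (hG : G < 2 ^ n)
    (hq₂ : 0 < q₂) (hc₂ : Nat.Coprime a₂ q₂) (hp₂ : ∀ p : ℕ, p.Prime → ¬ p ∣ q₂ → 7 ≤ p)
    (hz₂ : a₂ + q₂ * 2 ^ (4 * n + 8) ≤ 8 ^ 2 * (G ^ 2 * 2 ^ (4 * n + 8)))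
    (hq₃ : 0 < q₃) (hc₃ : Nat.Coprime a₃ q₃) (hp₃ : ∀ p : ℕ, p.Prime → ¬ p ∣ q₃ → 7 ≤ p)
    (hz₃ : a₃ + q₃ * 2 ^ (4 * n + 8) ≤ 8 ^ 2 * (G ^ 2 * 2 ^ (4 * n + 8)))
    (hq₄ : 0 < q₄) (hc₄ : Nat.Coprime a₄ q₄) (hp₄ : ∀ p : ℕ, p.Prime → ¬ p ∣ q₄ → 7 ≤ p)
    (hz₄ : a₄ + q₄ * 2 ^ (4 * n + 8) ≤ 16 ^ 2 * (G ^ 2 * 2 ^ (4 * n + 8)))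
    (himp : ∀ k, Squarefree (a₂ + q₂ * k) → Squarefree (a₃ + q₃ * k) →
      Squarefree (a₄ + q₄ * k) → P k) :
    2 ^ (4 * n + 8) ≤ 4 * ((Finset.range (2 ^ (4 * n + 8))).filter P).card := by
  have hX : 128 * 2 ^ (3 * n + 4) ≤ 2 ^ (4 * n + 8) := by
    rw [show 4 * n + 8 = (n + 4) + (3 * n + 4) by ring, pow_add 2 (n + 4) (3 * n + 4)]
    apply Nat.mul_le_mul_right
    calc 128 = 2 ^ 7 := by norm_num
      _ ≤ 2 ^ (n + 4) := Nat.pow_le_pow_right (by norm_num) (by omega)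
  -- the three sieve instances
  have h2 := hS a₂ q₂ (2 ^ (4 * n + 8)) 7 hq₂ hc₂ (by norm_num) hp₂
  have h3 := hS a₃ q₃ (2 ^ (4 * n + 8)) 7 hq₃ hc₃ (by norm_num) hp₃
  have h4 := hS a₄ q₄ (2 ^ (4 * n + 8)) 7 hq₄ hc₄ (by norm_num) hp₄
  -- covering
  have hcov := nagD_le_card_add₃ (K := 2 ^ (4 * n + 8)) himp
  -- sizes
  have hs2 : Nat.sqrt (a₂ + q₂ * 2 ^ (4 * n + 8)) ≤ 8 * 2 ^ (3 * n + 4) := fundAP_sqrt_le hG.le hz₂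
  have hs3 : Nat.sqrt (a₃ + q₃ * 2 ^ (4 * n + 8)) ≤ 8 * 2 ^ (3 * n + 4) := fundAP_sqrt_le hG.le hz₃
  have hs4 : Nat.sqrt (a₄ + q₄ * 2 ^ (4 * n + 8)) ≤ 16 * 2 ^ (3 * n + 4) :=
    fundAP_sqrt_le hG.le hz₄
  omega

/-- **Stub D · `stub_densityNagell`.** Granting the squarefree product lemma (first antecedent) and
the elementary squarefree sieve in arithmetic progressions (second antecedent), for `n ≥ 3` and
every squarefree `G` with `2 ∤ G`, `3 ∤ G`, `0 < G < 2^n`, at least one quarter of the seeds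
`j < 2^(4n+8)` make `G t (G t + 8) (4 G t + 27)`, `t = 1 + 11 G + 11 G² + 30 G j`, squarefree
(sieve at `(a₂, 30 G, 7)`, `(G a₂ + 8, 30 G², 7)`, `(4 G a₂ + 27, 120 G², 7)`,
`a₂ = 1 + 11 G + 11 G²`). -/
theorem stub_densityNagell :
    (∀ (G j : ℕ), Squarefree G → ¬ 2 ∣ G → ¬ 3 ∣ G →
      Squarefree (1 + 11 * G + 11 * G ^ 2 + 30 * G * j) →
      Squarefree (G * (1 + 11 * G + 11 * G ^ 2 + 30 * G * j) + 8) →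
      Squarefree (4 * (G * (1 + 11 * G + 11 * G ^ 2 + 30 * G * j)) + 27) →
        Squarefree (G * (1 + 11 * G + 11 * G ^ 2 + 30 * G * j) *
          (G * (1 + 11 * G + 11 * G ^ 2 + 30 * G * j) + 8) *
          (4 * (G * (1 + 11 * G + 11 * G ^ 2 + 30 * G * j)) + 27))) →
    (∀ (a q K p₀ : ℕ), 0 < q → Nat.Coprime a q → 2 ≤ p₀ →
      (∀ p : ℕ, p.Prime → ¬ p ∣ q → p₀ ≤ p) →
        (p₀ - 1) * ((Finset.range K).filter (fun k => ¬ Squarefree (a + q * k))).card ≤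
          K + (p₀ - 1) * Nat.sqrt (a + q * K)) →
    ∃ n₀ : ℕ, ∀ n, n₀ ≤ n → ∀ G : ℕ, Squarefree G → ¬ 2 ∣ G → ¬ 3 ∣ G → 0 < G → G < 2 ^ n →
      2 ^ (4 * n + 8) ≤ 4 * ((Finset.range (2 ^ (4 * n + 8))).filter (fun j =>
        Squarefree (G * (1 + 11 * G + 11 * G ^ 2 + 30 * G * j) *
          (G * (1 + 11 * G + 11 * G ^ 2 + 30 * G * j) + 8) *
          (4 * (G * (1 + 11 * G + 11 * G ^ 2 + 30 * G * j)) + 27)))).card := by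
  intro hC hS
  refine ⟨3, fun n hn G hG hG2 hG3 hG0 hGn => ?_⟩
  -- the sufficient condition, with the three factors written as arithmetic progressions in `j`
  have himp : ∀ j : ℕ, Squarefree (1 + 11 * G + 11 * G ^ 2 + 30 * G * j) →
      Squarefree (G * (1 + 11 * G + 11 * G ^ 2) + 8 + 30 * G ^ 2 * j) →
      Squarefree (4 * G * (1 + 11 * G + 11 * G ^ 2) + 27 + 120 * G ^ 2 * j) →
        Squarefree (G * (1 + 11 * G + 11 * G ^ 2 + 30 * G * j) *
          (G * (1 + 11 * G + 11 * G ^ 2 + 30 * G * j) + 8) *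
          (4 * (G * (1 + 11 * G + 11 * G ^ 2 + 30 * G * j)) + 27)) := by
    intro j ht h3 h4
    refine hC G j hG hG2 hG3 ht ?_ ?_
    · have e : G * (1 + 11 * G + 11 * G ^ 2 + 30 * G * j) + 8 =
          G * (1 + 11 * G + 11 * G ^ 2) + 8 + 30 * G ^ 2 * j := by ring
      rw [e]
      exact h3
    · have e : 4 * (G * (1 + 11 * G + 11 * G ^ 2 + 30 * G * j)) + 27 =
          4 * G * (1 + 11 * G + 11 * G ^ 2) + 27 + 120 * G ^ 2 * j := by ring
      rw [e]
      exact h4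
  -- bookkeeping for the size bounds
  have hK : 1 ≤ 2 ^ (4 * n + 8) := Nat.one_le_two_pow
  have hGG : G ≤ G ^ 2 := Nat.le_self_pow two_ne_zero G
  have hG2K : G ^ 2 ≤ G ^ 2 * 2 ^ (4 * n + 8) := Nat.le_mul_of_pos_right _ hK
  have hGK : G * 2 ^ (4 * n + 8) ≤ G ^ 2 * 2 ^ (4 * n + 8) := Nat.mul_le_mul_right _ hGG
  have hG3K : G ^ 3 ≤ G ^ 2 * 2 ^ (4 * n + 8) := by
    rw [pow_succ]
    exact Nat.mul_le_mul_left _ (hGn.le.trans (Nat.pow_le_pow_right (by norm_num) (by omega)))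
  refine nagD_density_core hS hn hGn
    (a₂ := 1 + 11 * G + 11 * G ^ 2) (q₂ := 30 * G)
    (a₃ := G * (1 + 11 * G + 11 * G ^ 2) + 8) (q₃ := 30 * G ^ 2)
    (a₄ := 4 * G * (1 + 11 * G + 11 * G ^ 2) + 27) (q₄ := 120 * G ^ 2)
    (by omega) (nagD_coprime₂ G) (fun p hp hpn => nagD_seven_le hp (dvd_mul_right 30 G) hpn) ?_
    (by positivity) (nagD_coprime₃ hG2)
    (fun p hp hpn => nagD_seven_le hp (dvd_mul_right 30 (G ^ 2)) hpn) ?_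
    (by positivity) (nagD_coprime₄ hG3)
    (fun p hp hpn => nagD_seven_le hp (Dvd.intro (4 * G ^ 2) (by ring)) hpn) ?_ himp
  · have e : 30 * G * 2 ^ (4 * n + 8) = 30 * (G * 2 ^ (4 * n + 8)) := by ring
    rw [e]
    omega
  · have e : G * (1 + 11 * G + 11 * G ^ 2) + 8 + 30 * G ^ 2 * 2 ^ (4 * n + 8) =
        G + 11 * G ^ 2 + 11 * G ^ 3 + 8 + 30 * (G ^ 2 * 2 ^ (4 * n + 8)) := by ring
    rw [e]
    omega
  · have e : 4 * G * (1 + 11 * G + 11 * G ^ 2) + 27 + 120 * G ^ 2 * 2 ^ (4 * n + 8) =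
        4 * G + 44 * G ^ 2 + 44 * G ^ 3 + 27 + 120 * (G ^ 2 * 2 ^ (4 * n + 8)) := by ring
    rw [e]
    omega

end Summit.QuantumAdvantage.QuantumAdvantage.Theorems.IqThreeNotPPoly
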